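import Literature.NumberTheory.LFunctions.HalaszRestrictedWindowSq
import HarnessLib

/-!
# Halász's theorem for block-restricted sums over windows, IV: the `L²` window from an abstract window bound

Topic `Literature/NumberTheory/LFunctions`.  Everything in this file is PROVED; no definitions, no named facts.

`HalaszRestrictedWindowSq.lean` (tree) turns the window form of the restricted Halász theorem
(`Halasz.Restricted.norm_restr_interval_sum_le`, main term `(1 + M_½) e^{-M_½}`) into the `L²` bound
`∫_{t₁-L_w}^{t₁+L_w} |D(t)|² dt ≤ K(((1+M₀)e^{-M₀})² + G²)` for the restricted Dirichlet polynomial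
`D(t) = ∑_{⌈X⌉ ≤ n ≤ ⌊2X⌋, n ∈ 𝒮} g(n) n^{-(1+it)}` by Gallagher's lemma; the window theorem enters through the hypothesis
`hH` of `integral_sq_restr_dirichlet_window_sq_le_of`, whose shape is EXACTLY that statement.  The sharp window theorem
`Halasz.Restricted.norm_restr_interval_sum_le_sharp` (`HalaszRestrictedSharp.lean`: main term `e^{-M/2}` with NO
polynomial factor, in the regime `34M + C_r ≤ log log x`, with an extra term `√(log x)/T` and hypotheses
`T ≤ νx`, `Q ≤ exp(√log νx + 1)`) has a different shape.  This file re-runs the Gallagher argument once, verbatim, for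
an ABSTRACT window bound at the twist `t₁`:

* `Halasz.Restricted.integral_sq_restr_dirichlet_window_sq_le_of_const` — if, for some constants `K₁ > 0`, `A ≥ 0`,
  every window `(x, νx]` with `X - 1 ≤ x ≤ 2X`, `1 < ν ≤ 2`, `ν - 1 ≥ δ₀` satisfies
  `|∑_{x < n ≤ νx, n ∈ 𝒮} g(n) n^{-it₁}| ≤ K₁((ν-1)x(A + 4/X + (|𝓙|+1)√((log Q+2)/log x) + √(log x)/(X/4)) + (|𝓙|+1)x(ν-1)^{-1/12}/√(log x) + x/log x + x/(X/4) + |E|)`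
  (the shape of both window theorems at `T = X/4`, the main term replaced by the constant `A`), then for
  `X ≥ 64`, `16 ≤ L_w ≤ X/8`, `0 < δ₀ ≤ 1`, `Q ≥ e²`:
  `∫_{t₁-L_w}^{t₁+L_w} |D|² ≤ 3(48K₁+6)² (A² + G²)`,
  `G = (|𝓙|+1)√((log Q+2)/log(X-1)) + (|𝓙|+1)L_w δ₀^{-1/12}/√(log(X-1)) + L_w/log(X-1) + L_w(|E|+15)/X + L_w δ₀ + L_w √(log 2X)/X`
  (the last term is new and absorbs `√(log x)/(X/4)`; it is `X^{-1+o(1)}`).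

With `A = e^{-M/2}` from the sharp theorem (in its regime) this gives the middle term `e^{-M}` of Matomäki–Radziwiłł–Tao
2015, Proposition A.3 AS PRINTED for completely multiplicative `f` (`MatomakiRadziwillTaoPropA3WindowSqSharp.lean`);
with `A = (1+M₀)e^{-M₀}` it is the tree's `integral_sq_restr_dirichlet_window_sq_le`.

## References
* P. X. Gallagher, Invent. Math. 11 (1970), Lemma 1 (tree: `Sieve/GallagherLemmaGeneral.lean`).
* K. Matomäki, M. Radziwiłł, T. Tao, Algebra & Number Theory 9 (2015), Appendix A, Proposition A.3 (proof: the
  ranges `𝒯₀ ∪ 𝒯₁`). [cite: MatomakiRadziwillTao2015, Appendix A, Proposition A.3 (proof)]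
* A. Granville, K. Soundararajan, Canad. J. Math. 55 (2003) (the method behind the window theorems).
  [cite: GranvilleSoundararajan2003, Theorem 1]

## Design choices
* The proof is that of `integral_sq_restr_dirichlet_window_sq_le_of` (same constants, same steps), with the window bound
  abstracted; all helper lemmas are the tree's (`coeff_mul_fourierChar`, `filter_window_eq`, `window_range_of_mem`,
  `sum_range_window_eq_S_sub`, …).
-/

noncomputable section

open Finset Real Complex MeasureTheory Filter
open scoped ComplexConjugate Classical FourierTransform

namespace Literature.NumberTheory.LFunctions

namespace Halasz

namespace Restricted

variable {𝓙 : Finset ℕ} {blk : ℕ → Finset ℕ} {g : ℕ → ℂ}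

set_option maxHeartbeats 3200000 in
/-- **The window in `L²` from an abstract window bound.**  See the module docstring: for `K₁ > 0`, `A ≥ 0` and a
completely multiplicative `1`-bounded `g`, if every window sum of `g n^{-it₁} 1_𝒮` over `(x, νx]`,
`X - 1 ≤ x ≤ 2X`, `1 < ν ≤ 2`, `ν - 1 ≥ δ₀`, is bounded by
`K₁((ν-1)x(A + 1/(X/4) + (|𝓙|+1)√((log Q+2)/log x) + √(log x)/(X/4)) + (|𝓙|+1)x(ν-1)^{-1/12}/√(log x) + x/log x + x/(X/4) + |E|)`,
then `∫_{t₁-L_w}^{t₁+L_w} |D(t)|² dt ≤ 3(48K₁+6)²(A² + G²)` (`X ≥ 64`, `16 ≤ L_w ≤ X/8`, `0 < δ₀ ≤ 1`, `Q ≥ e²`).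
Proof: Gallagher's lemma, `|W(x)| ≤ 3B/X` by partial summation from the window bound (trivial bound when
`ν' - 1 < δ₀`), `L_w (ν' - 1) ≤ 7` — verbatim from `integral_sq_restr_dirichlet_window_sq_le_of`.
[cite: MatomakiRadziwillTao2015, Appendix A, Proposition A.3 (proof)] -/
theorem integral_sq_restr_dirichlet_window_sq_le_of_const {K₁ A₀ : ℝ} (hK₁ : 0 < K₁) (hA0 : 0 ≤ A₀)
    (𝓙 : Finset ℕ) (blk : ℕ → Finset ℕ) (g : ℕ → ℂ) (hg : ∀ m n, g (m * n) = g m * g n) (hg1 : g 1 = 1)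
    (hgb : ∀ n, ‖g n‖ ≤ 1) {X Lw δ₀ Q t₁ : ℝ} (hX : 64 ≤ X) (hLw : 16 ≤ Lw) (hLwX : Lw ≤ X / 8)
    (hδ₀ : 0 < δ₀) (hδ₁ : δ₀ ≤ 1) (hQ : Real.exp 2 ≤ Q)
    (hsys : IsBlockSystem 𝓙 blk (⌈X⌉₊ - 1))
    (hH : ∀ x ν : ℝ, X - 1 ≤ x → x ≤ 2 * X → 1 < ν → ν ≤ 2 → δ₀ ≤ ν - 1 → IsBlockSystem 𝓙 blk ⌊ν * x⌋₊ →
      ‖S (restr 𝓙 blk (fun n : ℕ => g n * (n : ℂ) ^ (-((t₁ : ℂ) * I))) ⌊ν * x⌋₊) (ν * x) -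
          S (restr 𝓙 blk (fun n : ℕ => g n * (n : ℂ) ^ (-((t₁ : ℂ) * I))) ⌊ν * x⌋₊) x‖ ≤
        K₁ * ((ν - 1) * x * (A₀ + 1 / (X / 4) + (𝓙.card + 1) * Real.sqrt ((Real.log Q + 2) / Real.log x) +
            Real.sqrt (Real.log x) / (X / 4)) +
          (𝓙.card + 1) * x * (ν - 1) ^ (-(1 / 12 : ℝ)) / Real.sqrt (Real.log x) +
          x / Real.log x + x / (X / 4) + (𝓙.biUnion blk).card)) :
    ∫ t in (t₁ - Lw)..(t₁ + Lw),
        ‖∑ n ∈ (Finset.Icc ⌈X⌉₊ ⌊2 * X⌋₊).filter (MemBlocks 𝓙 blk), g n * (n : ℂ) ^ (-(1 + (t : ℂ) * I))‖ ^ 2 ≤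
      3 * (48 * K₁ + 6) ^ 2 * (A₀ ^ 2 +
        ((𝓙.card + 1) * Real.sqrt ((Real.log Q + 2) / Real.log (X - 1)) +
          (𝓙.card + 1) * Lw * δ₀ ^ (-(1 / 12 : ℝ)) / Real.sqrt (Real.log (X - 1)) +
          Lw / Real.log (X - 1) + Lw * ((𝓙.biUnion blk).card + 15) / X + Lw * δ₀ +
          Lw * Real.sqrt (Real.log (2 * X)) / X) ^ 2) := by
  -- the twisted function and the data
  set gt : ℕ → ℂ := fun n => g n * (n : ℂ) ^ (-((t₁ : ℂ) * I)) with hgt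
  have hgt_mul : ∀ m n, gt (m * n) = gt m * gt n := twist_mul hg t₁
  have hgt_one : gt 1 = 1 := twist_one hg1 t₁
  have hgt_b : ∀ n, ‖gt n‖ ≤ 1 := norm_mul_twist_le hgb t₁
  set E := 𝓙.biUnion blk with hE
  set m : ℝ := (𝓙.card : ℝ) with hm
  set Φ₀ : ℝ := A₀ with hΦ₀
  set ℓ₁ : ℝ := Real.log (X - 1) with hℓ₁
  set ρs : ℝ := Real.sqrt ((Real.log Q + 2) / ℓ₁) with hρs
  set G : ℝ := (m + 1) * ρs + (m + 1) * Lw * δ₀ ^ (-(1 / 12 : ℝ)) / Real.sqrt ℓ₁ + Lw / ℓ₁ +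
    Lw * (E.card + 15) / X + Lw * δ₀ + Lw * Real.sqrt (Real.log (2 * X)) / X with hG
  set C₁ : ℝ := 48 * K₁ + 6 with hC₁
  set S₀ : ℝ := C₁ * (Φ₀ + G) with hS₀
  -- sizes
  have hX0 : 0 < X := by linarith
  have hX16 : 16 ≤ X := by linarith
  have hLw0 : 0 < Lw := by linarith
  have hℓ₁1 : 1 < ℓ₁ := by
    have hX1 : Real.exp 1 < X - 1 := by have := Real.exp_one_lt_d9; linarith
    have h := Real.log_lt_log (Real.exp_pos 1) hX1
    rwa [Real.log_exp, ← hℓ₁] at h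
  have hℓ₁0 : 0 < ℓ₁ := by linarith
  have hm0 : 0 ≤ m := Nat.cast_nonneg _
  have hΦ₀0 : 0 ≤ Φ₀ := by positivity
  have hρs0 : 0 ≤ ρs := Real.sqrt_nonneg _
  have hcard0 : (0 : ℝ) ≤ E.card := Nat.cast_nonneg _
  have hδpow1 : 1 ≤ δ₀ ^ (-(1 / 12 : ℝ)) := by
    rw [Real.rpow_neg hδ₀.le, one_le_inv_iff₀]
    exact ⟨Real.rpow_pos_of_pos hδ₀ _, Real.rpow_le_one hδ₀.le hδ₁ (by norm_num)⟩
  have hG0 : 0 ≤ G := by positivity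
  have hC₁0 : 0 < C₁ := by positivity
  have hS₀0 : 0 ≤ S₀ := by positivity
  have hQ2 : 0 ≤ Real.log Q + 2 := by
    have : 0 ≤ Real.log Q := Real.log_nonneg (le_trans (Real.one_le_exp (by norm_num)) hQ)
    linarith
  -- the range of the windows
  have ha64 : 64 ≤ ⌈X⌉₊ := by
    have : (64 : ℝ) ≤ ⌈X⌉₊ := hX.trans (Nat.le_ceil X); exact_mod_cast this
  set ν₀ : ℝ := Real.exp (π / Lw) with hν₀
  have hπLw : π / Lw ≤ 1 / 4 := by
    rw [div_le_div_iff₀ hLw0 (by norm_num)]; nlinarith [Real.pi_lt_four]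
  have hν₀1 : 1 ≤ ν₀ := Real.one_le_exp (by positivity)
  have hu02 : π / Lw ≤ 0.2 := by
    rw [div_le_iff₀ hLw0]; nlinarith [Real.pi_lt_d2]
  have hν₀le : ν₀ ≤ 5 / 4 := by
    have h := Real.abs_exp_sub_one_sub_id_le (x := π / Lw) (by rw [abs_of_nonneg (by positivity)]; linarith)
    rw [abs_le] at h
    have hsq : (π / Lw) ^ 2 ≤ 0.04 := by
      have h0 : 0 ≤ π / Lw := by positivity
      nlinarith
    rw [hν₀]; linarith [h.2]
  have hν₀sub : ν₀ - 1 ≤ 2 * π / Lw := by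
    have := exp_sub_one_le_two_mul (u := π / Lw) (by positivity) (by linarith)
    rw [hν₀]; linarith [show 2 * (π / Lw) = 2 * π / Lw by ring]
  set ηmax : ℝ := 2 * π / Lw + 4 / X with hηmax
  have hηmax0 : 0 ≤ ηmax := by positivity
  have hLwη : Lw * ηmax ≤ 7 := by
    rw [hηmax, mul_add, mul_div_assoc', mul_div_assoc']
    rw [show Lw * (2 * π) / Lw = 2 * π by field_simp]
    have : Lw * 4 / X ≤ 1 / 2 := by rw [div_le_div_iff₀ hX0 (by norm_num)]; linarith
    linarith [Real.pi_lt_d2, this]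
  -- the uniform bound for the partial sums
  set u8 : ℝ := 4 * Real.sqrt (Real.log (2 * X)) / X with hu8
  have hu80 : 0 ≤ u8 := by positivity
  set B₁ : ℝ := K₁ * (ηmax * (2 * X) * (Φ₀ + 4 / X + (m + 1) * ρs + u8) +
    (m + 1) * (2 * X) * δ₀ ^ (-(1 / 12 : ℝ)) / Real.sqrt ℓ₁ + 2 * X / ℓ₁ + 8 + E.card) with hB₁
  set B : ℝ := B₁ + (2 * δ₀ * X + 1) with hBdef
  have hB₁0 : 0 ≤ B₁ := by positivity
  have hB0 : 0 ≤ B := by positivity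
  -- **Step 3**: every Gallagher window sum is `≤ 3B/X`
  have hwin : ∀ x : ℝ, ‖∑ n ∈ ((Finset.Icc ⌈X⌉₊ ⌊2 * X⌋₊).filter (MemBlocks 𝓙 blk)).filter
      (fun n : ℕ => x ≤ Real.log n / (2 * π) ∧ Real.log n / (2 * π) ≤ x + (2 * Lw)⁻¹),
        g n * (n : ℂ) ^ (-(1 + (t₁ : ℂ) * I))‖ ≤ 3 * B / X := by
    intro x
    rw [filter_window_eq hX0 hLw0 (MemBlocks 𝓙 blk) x]
    set Y : ℝ := Real.exp (2 * π * x) with hY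
    set a' : ℕ := max ⌈X⌉₊ ⌈Y⌉₊ with ha'
    set b' : ℕ := min ⌊2 * X⌋₊ ⌊ν₀ * Y⌋₊ with hb'
    have hY0 : 0 < Y := Real.exp_pos _
    have ha'X : ⌈X⌉₊ ≤ a' := le_max_left _ _
    have ha'Y : Y ≤ a' := (Nat.le_ceil Y).trans (by exact_mod_cast le_max_right _ _)
    have ha'1 : 1 ≤ a' := le_trans (by omega) ha'X
    have ha'Xr : X ≤ a' := (Nat.le_ceil X).trans (by exact_mod_cast ha'X)
    have hb'2X : (b' : ℝ) ≤ 2 * X := le_trans (by exact_mod_cast min_le_left _ _) (Nat.floor_le (by linarith))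
    have hb'Y : (b' : ℝ) ≤ ν₀ * Y := le_trans (by exact_mod_cast min_le_right _ _) (Nat.floor_le (by positivity))
    rcases lt_or_ge b' a' with hba | hab
    · rw [Finset.Icc_eq_empty_of_lt hba, Finset.filter_empty, Finset.sum_empty, norm_zero]; positivity
    -- now `a' ≤ b'`; hence `Y ≥ X/ν₀` and `a' - 1 ≥ X - 1`
    have hab' : (a' : ℝ) ≤ b' := by exact_mod_cast hab
    have hx'pos : 0 < (a' : ℝ) - 1 := by
      have : (64 : ℝ) ≤ a' := by exact_mod_cast ha64.trans ha'X
      linarith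
    have hx'X1 : X - 1 ≤ (a' : ℝ) - 1 := by linarith
    have hx'2X : (a' : ℝ) - 1 ≤ 2 * X := by linarith
    have hYX : X ≤ ν₀ * Y := ha'Xr.trans (hab'.trans hb'Y)
    have hY51 : 51 ≤ Y := by nlinarith [mul_le_mul_of_nonneg_right hν₀le hY0.le, hYX]
    -- rewrite as a `1/n`-weighted sum of `c'(n) = [n ≥ a'] g(n) n^{-it₁} 1_𝒮(n)`
    set c' : ℕ → ℂ := fun n => if n < a' then 0 else gt n * blockInd 𝓙 blk n with hc'
    rw [sum_filter_memBlocks_eq_sum_div ha'1 t₁]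
    have hcc : ∑ n ∈ Finset.Icc a' b', (if n = 0 then 0 else (g n * (n : ℂ) ^ (-((t₁ : ℂ) * I))) * blockInd 𝓙 blk n) / n =
        ∑ n ∈ Finset.Icc a' b', c' n / n := by
      refine Finset.sum_congr rfl fun n hn => ?_
      rw [Finset.mem_Icc] at hn
      simp only [hc', hgt]
      rw [if_neg (by omega), if_neg (by omega)]
    rw [hcc]
    -- the partial sums
    have hpart : ∀ k, a' ≤ k → k ≤ b' + 1 → ‖∑ i ∈ Finset.range k, c' i‖ ≤ B := by
      intro k hk hkb
      rw [hc', sum_range_window_eq_S_sub gt ha'1 hk le_rfl]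
      set x' : ℝ := ((a' - 1 : ℕ) : ℝ) with hx'
      have hx'eq : x' = (a' : ℝ) - 1 := by rw [hx', Nat.cast_sub ha'1]; norm_num
      set y' : ℝ := ((k - 1 : ℕ) : ℝ) with hy'
      have hy'eq : y' = (k : ℝ) - 1 := by rw [hy', Nat.cast_sub (by omega : 1 ≤ k)]; norm_num
      have hx'0 : 0 < x' := by rw [hx'eq]; exact hx'pos
      have hak' : (a' : ℝ) ≤ k := by exact_mod_cast hk
      have hxy : x' ≤ y' := by rw [hx'eq, hy'eq]; linarith
      have hy'2X : y' ≤ 2 * X := by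
        rw [hy'eq]; have : (k : ℝ) ≤ b' + 1 := by exact_mod_cast hkb
        linarith
      have hy'X1 : X - 1 ≤ y' := hx'X1.trans (by rw [← hx'eq]; exact hxy)
      set ν' : ℝ := y' / x' with hν'
      have hν'x : ν' * x' = y' := div_mul_cancel₀ y' hx'0.ne'
      have hν'1 : 1 ≤ ν' := by rw [hν', le_div_iff₀ hx'0, one_mul]; exact hxy
      -- `ν' - 1 ≤ ηmax`
      have hν'η : ν' - 1 ≤ ηmax := by
        have hsub : (ν' - 1) * x' = y' - x' := by rw [sub_mul, hν'x, one_mul]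
        have hnum : y' - x' ≤ (ν₀ - 1) * Y + 1 := by
          rw [hy'eq, hx'eq]
          have : (k : ℝ) ≤ b' + 1 := by exact_mod_cast hkb
          linarith
        have hden : Y - 1 ≤ x' := by rw [hx'eq]; linarith
        -- `(ν' - 1) ≤ ((ν₀-1) Y + 1)/(Y - 1) ≤ (ν₀ - 1) + 3/Y ≤ 2π/L_w + 4/X`
        have h1 : (ν' - 1) * (Y - 1) ≤ (ν₀ - 1) * Y + 1 := by
          have : (ν' - 1) * (Y - 1) ≤ (ν' - 1) * x' := mul_le_mul_of_nonneg_left hden (by linarith)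
          linarith
        have hY1 : 0 < Y - 1 := by linarith
        have h2 : ν' - 1 ≤ ((ν₀ - 1) * Y + 1) / (Y - 1) := by rw [le_div_iff₀ hY1]; exact h1
        have h3 : ((ν₀ - 1) * Y + 1) / (Y - 1) ≤ (ν₀ - 1) + 3 / Y := by
          rw [div_le_iff₀ hY1]
          have hν₀1' : 0 ≤ ν₀ - 1 := by linarith
          have e : ((ν₀ - 1) + 3 / Y) * (Y - 1) = (ν₀ - 1) * Y + 3 - (ν₀ - 1) - 3 / Y := by field_simp; ring
          rw [e]
          have : 3 / Y ≤ 3 / 51 := div_le_div_of_nonneg_left (by norm_num) (by norm_num) hY51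
          nlinarith
        have h4 : 3 / Y ≤ 4 / X := by
          rw [div_le_div_iff₀ hY0 hX0]; nlinarith [mul_le_mul_of_nonneg_right hν₀le hY0.le, hYX]
        linarith [h2, h3, h4, hν₀sub]
      rcases lt_or_ge (ν' - 1) δ₀ with hsmall | hlarge
      · -- trivial bound
        have htriv : ‖S (restr 𝓙 blk gt (k - 1)) y' - S (restr 𝓙 blk gt (k - 1)) x'‖ ≤ (ν' - 1) * x' := by
          have hfl : ⌊x'⌋₊ ≤ ⌊y'⌋₊ := Nat.floor_le_floor hxy
          refine (norm_S_sub_S_le (norm_restr_le_one hgt_b) hfl).trans ?_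
          rw [hx', hy', Nat.floor_natCast, Nat.floor_natCast, ← hy', ← hx', sub_mul, hν'x, one_mul]
        have : (ν' - 1) * x' ≤ δ₀ * (2 * X) :=
          mul_le_mul hsmall.le (by rw [hx'eq]; exact hx'2X) hx'0.le hδ₀.le
        rw [hBdef]; linarith only [htriv, this, hB₁0]
      · -- the window theorem
        have hν'gt : 1 < ν' := by linarith
        have hν'2 : ν' ≤ 2 := by
          rw [hν', div_le_iff₀ hx'0]
          have : y' ≤ ν₀ * Y := by
            rw [hy'eq]; have : (k : ℝ) ≤ b' + 1 := by exact_mod_cast hkb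
            linarith
          have hden : Y - 1 ≤ x' := by rw [hx'eq]; linarith
          nlinarith [mul_le_mul_of_nonneg_right hν₀le hY0.le]
        have hx'3 : 3 ≤ x' := by rw [hx'eq]; linarith
        have hsys' : IsBlockSystem 𝓙 blk ⌊ν' * x'⌋₊ := by
          rw [hν'x, hy', Nat.floor_natCast]
          exact isBlockSystem_mono_N hsys (by omega)
        have hx'X1r : X - 1 ≤ x' := by rw [hx'eq]; exact hx'X1
        have hx'2Xr : x' ≤ 2 * X := by rw [hx'eq]; exact hx'2X
        have h := hH x' ν' hx'X1r hx'2Xr hν'gt hν'2 hlarge hsys'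
        rw [hν'x] at h
        rw [hy', Nat.floor_natCast, ← hy'] at h
        refine h.trans ?_
        -- compare term by term with `B₁`
        have hlogx' : ℓ₁ ≤ Real.log x' := Real.log_le_log (by linarith) (by rw [hx'eq]; exact hx'X1)
        have hlogx'0 : 0 < Real.log x' := hℓ₁0.trans_le hlogx'
        have hρ' : Real.sqrt ((Real.log Q + 2) / Real.log x') ≤ ρs :=
          Real.sqrt_le_sqrt (div_le_div_of_nonneg_left hQ2 hℓ₁0 hlogx')
        have hpow : (ν' - 1) ^ (-(1 / 12 : ℝ)) ≤ δ₀ ^ (-(1 / 12 : ℝ)) :=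
          Real.rpow_le_rpow_of_nonpos hδ₀ hlarge (by norm_num)
        have hsq : 1 / Real.sqrt (Real.log x') ≤ 1 / Real.sqrt ℓ₁ :=
          one_div_le_one_div_of_le (Real.sqrt_pos.2 hℓ₁0) (Real.sqrt_le_sqrt hlogx')
        have hν'0 : 0 ≤ ν' - 1 := by linarith
        -- term 1
        have hT1 : (ν' - 1) * x' * (Φ₀ + 1 / (X / 4) + (m + 1) * Real.sqrt ((Real.log Q + 2) / Real.log x') +
            Real.sqrt (Real.log x') / (X / 4)) ≤
            ηmax * (2 * X) * (Φ₀ + 4 / X + (m + 1) * ρs + u8) := by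
          have hsqlog : Real.sqrt (Real.log x') ≤ Real.sqrt (Real.log (2 * X)) :=
            Real.sqrt_le_sqrt (Real.log_le_log (by linarith) hx'2Xr)
          have h1 : Φ₀ + 1 / (X / 4) + (m + 1) * Real.sqrt ((Real.log Q + 2) / Real.log x') +
              Real.sqrt (Real.log x') / (X / 4) ≤ Φ₀ + 4 / X + (m + 1) * ρs + u8 := by
            have e1 : 1 / (X / 4) = 4 / X := by field_simp
            have e2 : Real.sqrt (Real.log x') / (X / 4) = 4 * Real.sqrt (Real.log x') / X := by
              rw [div_div_eq_mul_div]; ring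
            rw [e1, e2, hu8]
            have := mul_le_mul_of_nonneg_left hρ' (by linarith : 0 ≤ m + 1)
            have h4 : 4 * Real.sqrt (Real.log x') / X ≤ 4 * Real.sqrt (Real.log (2 * X)) / X :=
              div_le_div_of_nonneg_right (by linarith) hX0.le
            linarith
          have h0 : 0 ≤ Φ₀ + 1 / (X / 4) + (m + 1) * Real.sqrt ((Real.log Q + 2) / Real.log x') +
              Real.sqrt (Real.log x') / (X / 4) := by positivity
          calc (ν' - 1) * x' * _ ≤ ηmax * (2 * X) * _ :=
                mul_le_mul_of_nonneg_right (mul_le_mul hν'η (by rw [hx'eq]; exact hx'2X) hx'0.le hηmax0) h0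
            _ ≤ ηmax * (2 * X) * (Φ₀ + 4 / X + (m + 1) * ρs + u8) := mul_le_mul_of_nonneg_left h1 (by positivity)
        -- term 2
        have hT2 : (m + 1) * x' * (ν' - 1) ^ (-(1 / 12 : ℝ)) / Real.sqrt (Real.log x') ≤
            (m + 1) * (2 * X) * δ₀ ^ (-(1 / 12 : ℝ)) / Real.sqrt ℓ₁ := by
          rw [div_eq_mul_one_div, div_eq_mul_one_div ((m + 1) * (2 * X) * δ₀ ^ (-(1 / 12 : ℝ)))]
          have hpow0 : 0 ≤ (ν' - 1) ^ (-(1 / 12 : ℝ)) := Real.rpow_nonneg hν'0 _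
          refine mul_le_mul ?_ hsq (by positivity) (by positivity)
          exact mul_le_mul (mul_le_mul_of_nonneg_left (by rw [hx'eq]; exact hx'2X) (by linarith)) hpow hpow0
            (by positivity)
        -- term 3
        have hT3 : x' / Real.log x' ≤ 2 * X / ℓ₁ := by
          rw [div_le_div_iff₀ hlogx'0 hℓ₁0]
          calc x' * ℓ₁ ≤ 2 * X * ℓ₁ := mul_le_mul_of_nonneg_right (by rw [hx'eq]; exact hx'2X) hℓ₁0.le
            _ ≤ 2 * X * Real.log x' := mul_le_mul_of_nonneg_left hlogx' (by linarith)
        -- term 4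
        have hT4 : x' / (X / 4) ≤ 8 := by
          rw [div_le_iff₀ (by linarith)]; rw [hx'eq]; linarith
        rw [hBdef, hB₁]
        have hsum : (ν' - 1) * x' * (Φ₀ + 1 / (X / 4) + (m + 1) * Real.sqrt ((Real.log Q + 2) / Real.log x') +
            Real.sqrt (Real.log x') / (X / 4)) +
            (m + 1) * x' * (ν' - 1) ^ (-(1 / 12 : ℝ)) / Real.sqrt (Real.log x') + x' / Real.log x' + x' / (X / 4) + E.card ≤
            ηmax * (2 * X) * (Φ₀ + 4 / X + (m + 1) * ρs + u8) +
            (m + 1) * (2 * X) * δ₀ ^ (-(1 / 12 : ℝ)) / Real.sqrt ℓ₁ + 2 * X / ℓ₁ + 8 + E.card := by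
          linarith only [hT1, hT2, hT3, hT4]
        have := mul_le_mul_of_nonneg_left hsum hK₁.le
        rw [hm] at this ⊢
        have hpos : 0 ≤ 2 * δ₀ * X + 1 := by positivity
        linarith only [this, hpos]
    -- partial summation
    have hPS := Sieve.MatomakiRadziwillL3.norm_sum_div_le_of_partial (g := c') ha'1 hab hpart
    refine hPS.trans ?_
    have ha'0 : (0 : ℝ) < a' := by linarith
    rw [div_le_div_iff₀ ha'0 hX0]
    have := mul_le_mul_of_nonneg_left ha'Xr (by positivity : 0 ≤ 3 * B)
    linarith only [this]
  -- **Step 2**: the Gallagher majorant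
  set x₁ : ℝ := Real.log X / (2 * π) - (2 * Lw)⁻¹ with hx₁
  set x₂ : ℝ := Real.log (2 * X) / (2 * π) with hx₂
  have hx12 : x₂ - x₁ ≤ 0.15 := by
    have hlog2 : Real.log 2 < 0.6931471808 := Real.log_two_lt_d9
    have e : x₂ - x₁ = Real.log 2 / (2 * π) + (2 * Lw)⁻¹ := by
      rw [hx₂, hx₁, Real.log_mul (by norm_num) hX0.ne']; field_simp; ring
    rw [e]
    have h1 : Real.log 2 / (2 * π) ≤ 0.7 / 6 := by
      rw [div_le_div_iff₀ (by positivity) (by norm_num)]; nlinarith [Real.pi_gt_three]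
    have h2 : (2 * Lw)⁻¹ ≤ 1 / 32 := by rw [inv_eq_one_div]; exact one_div_le_one_div_of_le (by norm_num) (by linarith)
    linarith only [h1, h2, show (0.7 : ℝ) / 6 + 1 / 32 ≤ 0.15 by norm_num]
  have hx12' : x₁ ≤ x₂ := by
    have : 0 ≤ Real.log 2 / (2 * π) + (2 * Lw)⁻¹ := by positivity
    have e : x₂ - x₁ = Real.log 2 / (2 * π) + (2 * Lw)⁻¹ := by
      rw [hx₂, hx₁, Real.log_mul (by norm_num) hX0.ne']; field_simp; ring
    linarith
  set Mj : ℝ → ℝ := (Set.Icc x₁ x₂).indicator (fun _ => S₀ ^ 2) with hMj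
  have hMjint : Integrable Mj :=
    (integrable_indicator_iff measurableSet_Icc).2 (integrableOn_const (measure_Icc_lt_top.ne))
  have hMjval : ∫ x, Mj x = S₀ ^ 2 * (x₂ - x₁) := by
    rw [hMj, integral_indicator measurableSet_Icc, setIntegral_const, Real.volume_real_Icc_of_le hx12', smul_eq_mul]
    ring
  -- the key pointwise bound `‖L_w W(x)‖ ≤ S₀` on `[x₁, x₂]` (from `hwin`) and `W = 0` outside
  have hLwW : Lw * (3 * B / X) ≤ S₀ := by
    -- `3 L_w B/X ≤ C₁ (Φ₀ + G)`
    rw [hS₀, hC₁, hBdef, hB₁, hG]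
    have hLX : Lw / X ≤ 1 / 8 := by rw [div_le_div_iff₀ hX0 (by norm_num)]; linarith
    -- rewrite `L_w · (3B/X)` as a sum of the scaled terms
    have e : Lw * (3 * (K₁ * (ηmax * (2 * X) * (Φ₀ + 4 / X + (m + 1) * ρs + u8) +
        (m + 1) * (2 * X) * δ₀ ^ (-(1 / 12 : ℝ)) / Real.sqrt ℓ₁ + 2 * X / ℓ₁ + 8 + E.card) + (2 * δ₀ * X + 1)) / X) =
        3 * K₁ * (2 * (Lw * ηmax) * (Φ₀ + 4 / X + (m + 1) * ρs + u8) +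
          2 * ((m + 1) * Lw * δ₀ ^ (-(1 / 12 : ℝ)) / Real.sqrt ℓ₁) + 2 * (Lw / ℓ₁) + 8 * (Lw / X) + Lw * E.card / X) +
        6 * (Lw * δ₀) + 3 * (Lw / X) := by
      field_simp
      ring
    rw [e]
    have hu1 : 0 ≤ Φ₀ + 4 / X + (m + 1) * ρs + u8 := by positivity
    have hA : 2 * (Lw * ηmax) * (Φ₀ + 4 / X + (m + 1) * ρs + u8) ≤ 14 * (Φ₀ + 4 / X + (m + 1) * ρs + u8) := by
      have := mul_le_mul_of_nonneg_right hLwη hu1; linarith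
    have hu2 : 0 ≤ (m + 1) * Lw * δ₀ ^ (-(1 / 12 : ℝ)) / Real.sqrt ℓ₁ := by positivity
    have hu3 : 0 ≤ Lw / ℓ₁ := by positivity
    have hu4 : 0 ≤ Lw / X := by positivity
    have hu5 : 0 ≤ Lw * E.card / X := by positivity
    have hu6 : 0 ≤ Lw * δ₀ := by positivity
    have hu7 : 0 ≤ (m + 1) * ρs := by positivity
    -- `4/X ≤ L_w/(4X)·… `: `56/X ≤ 4 L_w/X` since `L_w ≥ 16`
    have h56 : 14 * (4 / X) ≤ 4 * (Lw / X) := by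
      rw [show 14 * (4 / X) = 56 / X by ring, show 4 * (Lw / X) = 4 * Lw / X by ring]
      exact div_le_div_of_nonneg_right (by linarith) hX0.le
    have hsplit : Lw * (E.card + 15) / X = Lw * E.card / X + 15 * (Lw / X) := by ring
    rw [hsplit]
    -- the extra term: `14 u8 = 56 √(log 2X)/X ≤ 4 L_w √(log 2X)/X`
    have hu9 : 0 ≤ Lw * Real.sqrt (Real.log (2 * X)) / X := by positivity
    have h56b : 14 * u8 ≤ 4 * (Lw * Real.sqrt (Real.log (2 * X)) / X) := by
      rw [hu8, show 14 * (4 * Real.sqrt (Real.log (2 * X)) / X) = 56 * Real.sqrt (Real.log (2 * X)) / X by ring,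
        show 4 * (Lw * Real.sqrt (Real.log (2 * X)) / X) = 4 * Lw * Real.sqrt (Real.log (2 * X)) / X by ring]
      refine div_le_div_of_nonneg_right ?_ hX0.le
      have hs0 : 0 ≤ Real.sqrt (Real.log (2 * X)) := Real.sqrt_nonneg _
      have h4 : (56 : ℝ) ≤ 4 * Lw := by linarith
      calc 56 * Real.sqrt (Real.log (2 * X)) ≤ (4 * Lw) * Real.sqrt (Real.log (2 * X)) :=
            mul_le_mul_of_nonneg_right h4 hs0
        _ = 4 * Lw * Real.sqrt (Real.log (2 * X)) := by ring
    have hA' := mul_le_mul_of_nonneg_left hA (by positivity : (0:ℝ) ≤ 3 * K₁)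
    have h56' := mul_le_mul_of_nonneg_left h56 (by positivity : (0:ℝ) ≤ 3 * K₁)
    have h56b' := mul_le_mul_of_nonneg_left h56b (by positivity : (0:ℝ) ≤ 3 * K₁)
    have k1 := mul_nonneg hK₁.le hΦ₀0
    have k2 := mul_nonneg hK₁.le hu7
    have k3 := mul_nonneg hK₁.le hu2
    have k4 := mul_nonneg hK₁.le hu3
    have k5 := mul_nonneg hK₁.le hu4
    have k6 := mul_nonneg hK₁.le hu5
    have k7 := mul_nonneg hK₁.le hu6
    have k8 := mul_nonneg hK₁.le hu9
    linarith only [hA', h56', h56b', k1, k2, k3, k4, k5, k6, k7, k8, hΦ₀0, hu7, hu2, hu3, hu4, hu5, hu6, hu80, hu9]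
  have hpt : ∀ x : ℝ, ‖(Lw : ℂ) * ∑ n ∈ ((Finset.Icc ⌈X⌉₊ ⌊2 * X⌋₊).filter (MemBlocks 𝓙 blk)).filter
      (fun n : ℕ => x ≤ Real.log n / (2 * π) ∧ Real.log n / (2 * π) ≤ x + (2 * Lw)⁻¹),
        g n * (n : ℂ) ^ (-(1 + (t₁ : ℂ) * I))‖ ^ 2 ≤ Mj x := by
    intro x
    by_cases hne : (((Finset.Icc ⌈X⌉₊ ⌊2 * X⌋₊).filter (MemBlocks 𝓙 blk)).filter
        (fun n : ℕ => x ≤ Real.log n / (2 * π) ∧ Real.log n / (2 * π) ≤ x + (2 * Lw)⁻¹)).Nonempty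
    · obtain ⟨n, hn⟩ := hne
      rw [Finset.mem_filter, Finset.mem_filter] at hn
      obtain ⟨hr1, hr2⟩ := window_range_of_mem hX0 (ϰ := Lw) hn.1.1 hn.2
      have hxmem : x ∈ Set.Icc x₁ x₂ := ⟨hr1, hr2⟩
      rw [hMj, Set.indicator_of_mem hxmem, norm_mul, Complex.norm_real, Real.norm_of_nonneg hLw0.le]
      have hle := (mul_le_mul_of_nonneg_left (hwin x) hLw0.le).trans hLwW
      exact pow_le_pow_left₀ (by positivity) hle 2
    · rw [Finset.not_nonempty_iff_eq_empty] at hne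
      rw [hne, Finset.sum_empty, mul_zero, norm_zero, zero_pow two_ne_zero]
      simp only [hMj]
      exact Set.indicator_nonneg (fun _ _ => by positivity) x
  -- **Step 1**: Gallagher's lemma
  set A : Finset ℕ := (Finset.Icc ⌈X⌉₊ ⌊2 * X⌋₊).filter (MemBlocks 𝓙 blk) with hA
  have hGal := Literature.NumberTheory.Sieve.Gallagher.gallagher_lemma_general A (fun n : ℕ => Real.log n / (2 * π))
    (fun n : ℕ => g n * (n : ℂ) ^ (-(1 + (t₁ : ℂ) * I))) hLw0
  -- identify the left-hand side
  have hLHS : ∫ η in (-Lw)..Lw, ‖∑ i ∈ A, g i * (i : ℂ) ^ (-(1 + (t₁ : ℂ) * I)) * (𝐞 (Real.log i / (2 * π) * η) : ℂ)‖ ^ 2 =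
      ∫ t in (t₁ - Lw)..(t₁ + Lw), ‖∑ n ∈ A, g n * (n : ℂ) ^ (-(1 + (t : ℂ) * I))‖ ^ 2 := by
    have hsum : ∀ η : ℝ, ∑ i ∈ A, g i * (i : ℂ) ^ (-(1 + (t₁ : ℂ) * I)) * (𝐞 (Real.log i / (2 * π) * η) : ℂ) =
        ∑ n ∈ A, g n * (n : ℂ) ^ (-(1 + ((t₁ - η : ℝ) : ℂ) * I)) := by
      intro η
      refine Finset.sum_congr rfl fun n hn => ?_
      rw [hA, Finset.mem_filter, Finset.mem_Icc] at hn
      exact coeff_mul_fourierChar (by omega) (g n) t₁ η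
    simp_rw [hsum]
    rw [intervalIntegral.integral_comp_sub_left (fun t : ℝ => ‖∑ n ∈ A, g n * (n : ℂ) ^ (-(1 + (t : ℂ) * I))‖ ^ 2) t₁]
    simp
  rw [hLHS] at hGal
  refine hGal.trans ?_
  -- integrate the majorant
  have hI : ∫ x : ℝ, ‖(Lw : ℂ) * ∑ n ∈ A.filter
      (fun n : ℕ => x ≤ Real.log n / (2 * π) ∧ Real.log n / (2 * π) ≤ x + (2 * Lw)⁻¹),
        g n * (n : ℂ) ^ (-(1 + (t₁ : ℂ) * I))‖ ^ 2 ≤ S₀ ^ 2 * 0.15 := by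
    refine (integral_mono_of_nonneg (Filter.Eventually.of_forall fun x => by positivity) hMjint
      (Filter.Eventually.of_forall hpt)).trans ?_
    rw [hMjval]
    exact mul_le_mul_of_nonneg_left hx12 (sq_nonneg _)
  have hπ10 : π ^ 2 ≤ 10 :=
    calc π ^ 2 ≤ 3.15 ^ 2 := pow_le_pow_left₀ Real.pi_pos.le Real.pi_lt_d2.le 2
      _ ≤ 10 := by norm_num
  calc π ^ 2 * ∫ x : ℝ, ‖(Lw : ℂ) * ∑ n ∈ A.filter
        (fun n : ℕ => x ≤ Real.log n / (2 * π) ∧ Real.log n / (2 * π) ≤ x + (2 * Lw)⁻¹),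
          g n * (n : ℂ) ^ (-(1 + (t₁ : ℂ) * I))‖ ^ 2
      ≤ 10 * (S₀ ^ 2 * 0.15) := by
        refine mul_le_mul hπ10 hI ?_ (by norm_num)
        exact integral_nonneg fun x => by positivity
    _ = 1.5 * (C₁ * (Φ₀ + G)) ^ 2 := by rw [hS₀]; ring
    _ ≤ 3 * C₁ ^ 2 * (Φ₀ ^ 2 + G ^ 2) := by
        have := mul_nonneg (sq_nonneg C₁) (sq_nonneg (Φ₀ - G))
        linarith only [this]
    _ = 3 * (48 * K₁ + 6) ^ 2 * (Φ₀ ^ 2 + G ^ 2) := by rw [hC₁]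

end Restricted

end Halasz

end Literature.NumberTheory.LFunctions
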